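import Mathlib.Analysis.Matrix.Spectrum
import Mathlib.Analysis.Matrix.Order
import Summits.QuantumFields.BalabanUV.Beta.GAN24.MonotoneCoarsen

/-!
# Beta / GAN24 / MonotoneCritical — THE CANONICAL CONSTRAINED COVARIANCE of a degenerate Gaussian (no gauge fixing): a Hermitian
# pseudo-inverse, the kernel projector of the constraint rows, and a covariance matrix whose columns are CRITICAL
# (`MonotoneCoarsen.IsCrit`) at every source invisible to the constrained zero modes
# (gan24-p4 gen 3; BINDER-OWNERS row G-an2-4 ∕ (CONV-C), ALTERNATIVE DISCHARGE «rate OR monotonicity»; NOT IN PRINT — our proof attempt)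

HONEST FRAMING (page 1 of everything the β sub-cell writes): discharging `BetaPertH` makes Bałaban's UV stability UNCONDITIONAL — a
real constructive-QFT result; it is NOT the continuum limit and NOT the Clay problem.  HONEST DEPENDENCY (cell reorg 2026-08-19, verbatim):
«continuum YM on T⁴ ⇐ BetaPertH ∧ nine spine estimates (0/9 proved); BetaPertH ⇐ (D1) ∧ (D4) ∧ CAP+tail; G-an2-4 gates asym, D1 and NE2/3/4.»
HONEST LABEL: «not in print; our proof attempt; alternative discharge of the G-an2-4 row (rate OR monotonicity)»; 0 wall binders instantiated.
ABSOLUTE RULE honoured: nothing is cited; [folklore] finite-dimensional linear algebra (spectral theorem of Mathlib, generalized inverses);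
no `def … : Prop` is asserted of anything.

## WHY (road P4, `HOME/b2b-balaban-gan24-p4/SKELETON-P4.md` node P4-N4 and §5 exit (iv′))
The read-out chain `MonotoneCoarsenReadOut.readOut_chain_step` (gen 2) takes, per level, a Hermitian covariance matrix `Γ` whose columns
at the read sources are CRITICAL for the (degenerate) energy form `H` on the gauge-FREE constraint space `ker Q` — for a KKT system this is
«the gauge multiplier does no work» (an5's `McolSum_eq_zero`, asym1's `GaugeSliceLegitimacy`).  THIS FILE removes the gauge fixing from the
picture altogether: for EVERY PSD `H` and EVERY constraint matrix `Q` there is ONE Hermitian matrix `critCov H Q` whose column at a source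
`r` is critical on `ker Q` as soon as `r` is orthogonal to the constrained zero modes `ker Q ∩ ker H` (and only then can a critical point
exist at all, `orth_zeroModes_of_isCrit`).  By slice independence (`MonotoneCoarsen.pairing_eq_of_isCrit`) its pairings agree with those
of the KKT columns of ANY legitimate gauge slice.  Consumer: `GAN24/MonotoneTorusTower` (the chain instantiated on Bałaban's typed torus averages).

## WHAT IS PROVED
* §1 `hpinv hA` — the Hermitian pseudo-inverse `U·diag(λ⁻¹)·U⋆` of a Hermitian matrix (`0⁻¹ = 0`); `hpinv_isHermitian`;
  **`mulVec_hpinv_mulVec_of_orth_ker`**: `A (A⁺ y) = y` for every `y` orthogonal to `ker A`.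
* §2 `kerProj Q := 1 − Qᴴ (QQᴴ)⁺ Q` — a Hermitian idempotent with `Q · kerProj Q = 0` and `kerProj Q v = v` for `Q v = 0`
  (no rank hypothesis on `Q`).
* §3 `critCov H Q := P (P H P)⁺ P` (`P = kerProj Q`): `critCov_isHermitian`, `critCov_conjTranspose`, `critCov_mem_ker`, and
  **`isCrit_critCov`**: `H` PSD, `r ⊥ (ker Q ∩ ker H)` ⟹ `IsCrit H r (ker Q) (critCov H Q r)`; conversely `orth_zeroModes_of_isCrit`.
NOT BetaPertH, NOT continuum, NOT Clay.
-/

namespace Summit.QuantumFields.BalabanUV.Beta.GAN24.MonotoneCritical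

open Matrix
open scoped ComplexOrder
open Summit.QuantumFields.BalabanUV.Beta.GAN24.MonotoneCoarsen (IsCrit conj_pairing)

/-! ## §1 The Hermitian pseudo-inverse -/

section Pinv

variable {𝕜 : Type*} [RCLike 𝕜] {n : Type*} [Fintype n] [DecidableEq n]

/-- The pseudo-inverse of a Hermitian matrix: `U · diag((λ_i)⁻¹) · U⋆` over an orthonormal eigenbasis (`0⁻¹ = 0`). [folklore] -/
noncomputable def hpinv {A : Matrix n n 𝕜} (hA : A.IsHermitian) : Matrix n n 𝕜 :=
  (hA.eigenvectorUnitary : Matrix n n 𝕜) * diagonal (fun i => ((RCLike.ofReal (hA.eigenvalues i) : 𝕜))⁻¹) *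
    star (hA.eigenvectorUnitary : Matrix n n 𝕜)

omit [DecidableEq n] in
/-- A real-inverse diagonal is self-adjoint entrywise. [folklore] -/
theorem star_inv_ofReal (x : ℝ) : star ((RCLike.ofReal x : 𝕜))⁻¹ = ((RCLike.ofReal x : 𝕜))⁻¹ := by
  rw [star_inv₀, RCLike.star_def, RCLike.conj_ofReal]

/-- The pseudo-inverse of a Hermitian matrix is Hermitian. [folklore] -/
theorem hpinv_isHermitian {A : Matrix n n 𝕜} (hA : A.IsHermitian) : (hpinv hA).IsHermitian := by
  have hD : (diagonal (fun i => ((RCLike.ofReal (hA.eigenvalues i) : 𝕜))⁻¹)).IsHermitian := by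
    rw [IsHermitian, diagonal_conjTranspose]
    congr 1
    funext i
    exact star_inv_ofReal _
  have h := Matrix.isHermitian_mul_mul_conjTranspose (hA.eigenvectorUnitary : Matrix n n 𝕜) hD
  rwa [← star_eq_conjTranspose] at h

/-- The `i`-th coordinate of `U⋆ y` is the pairing of `y` with the `i`-th eigenvector. [folklore] -/
theorem star_unitary_mulVec_apply {A : Matrix n n 𝕜} (hA : A.IsHermitian) (y : n → 𝕜) (i : n) :
    (star (hA.eigenvectorUnitary : Matrix n n 𝕜) *ᵥ y) i = star (⇑(hA.eigenvectorBasis i)) ⬝ᵥ y := by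
  simp only [mulVec, dotProduct, star_apply, IsHermitian.eigenvectorUnitary_apply, Pi.star_apply]

/-- **`A (A⁺ y) = y` FOR `y ⊥ ker A`.**  If `y` is orthogonal to every null vector of the Hermitian matrix `A`, the pseudo-inverse solves
`A x = y`. [folklore] -/
theorem mulVec_hpinv_mulVec_of_orth_ker {A : Matrix n n 𝕜} (hA : A.IsHermitian) {y : n → 𝕜}
    (hy : ∀ x, A *ᵥ x = 0 → star x ⬝ᵥ y = 0) : A *ᵥ (hpinv hA *ᵥ y) = y := by
  set U : Matrix n n 𝕜 := (hA.eigenvectorUnitary : Matrix n n 𝕜) with hU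
  have hUU : U * star U = 1 := by
    rw [hU]; exact Unitary.coe_mul_star_self hA.eigenvectorUnitary
  have hUU' : star U * U = 1 := by
    rw [hU]; exact Unitary.coe_star_mul_self hA.eigenvectorUnitary
  set D : Matrix n n 𝕜 := diagonal (RCLike.ofReal ∘ hA.eigenvalues) with hD
  set Dp : Matrix n n 𝕜 := diagonal (fun i => ((RCLike.ofReal (hA.eigenvalues i) : 𝕜))⁻¹) with hDp
  have hAeq : A = U * D * star U := by
    have h := hA.spectral_theorem
    rw [Unitary.conjStarAlgAut_apply] at h
    rw [hU, hD]
    exact h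
  -- the coordinates of `y` in the eigenbasis vanish on the kernel
  set c : n → 𝕜 := star U *ᵥ y with hc
  have hc0 : ∀ i, hA.eigenvalues i = 0 → c i = 0 := by
    intro i hi
    rw [hc, hU, star_unitary_mulVec_apply]
    apply hy
    rw [hA.mulVec_eigenvectorBasis i, hi, zero_smul]
  have hDD : D *ᵥ (Dp *ᵥ c) = c := by
    funext i
    rw [hD, hDp, mulVec_diagonal, mulVec_diagonal, Function.comp_apply]
    by_cases hi : hA.eigenvalues i = 0
    · rw [hc0 i hi, mul_zero, mul_zero]
    · have hne : (RCLike.ofReal (hA.eigenvalues i) : 𝕜) ≠ 0 := by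
        exact_mod_cast hi
      rw [← mul_assoc, mul_inv_cancel₀ hne, one_mul]
  calc A *ᵥ (hpinv hA *ᵥ y) = (U * D * star U) *ᵥ ((U * Dp * star U) *ᵥ y) := by rw [← hAeq]; rfl
    _ = U *ᵥ (D *ᵥ ((star U * U) *ᵥ (Dp *ᵥ (star U *ᵥ y)))) := by
        simp only [← mulVec_mulVec]
    _ = U *ᵥ (D *ᵥ (Dp *ᵥ c)) := by rw [hUU', one_mulVec]
    _ = U *ᵥ (star U *ᵥ y) := by rw [hDD]
    _ = y := by rw [mulVec_mulVec, hUU, one_mulVec]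

end Pinv

/-! ## §2 The kernel projector of a constraint matrix -/

section KerProj

variable {𝕜 : Type*} [RCLike 𝕜] {n m : Type*} [Fintype n] [DecidableEq n] [Fintype m] [DecidableEq m]

/-- The Hermitian projector onto `ker Q`: `1 − Qᴴ (Q Qᴴ)⁺ Q` (no rank hypothesis on `Q`). [folklore] -/
noncomputable def kerProj (Q : Matrix m n 𝕜) : Matrix n n 𝕜 :=
  1 - Qᴴ * hpinv (Matrix.isHermitian_mul_conjTranspose_self Q) * Q

/-- `kerProj Q` is Hermitian. [folklore] -/
theorem kerProj_isHermitian (Q : Matrix m n 𝕜) : (kerProj Q).IsHermitian := by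
  unfold kerProj
  refine Matrix.isHermitian_one.sub ?_
  have h := Matrix.isHermitian_conjTranspose_mul_mul Q (hpinv_isHermitian (Matrix.isHermitian_mul_conjTranspose_self Q))
  simpa [Matrix.mul_assoc] using h

/-- `(kerProj Q)ᴴ = kerProj Q`. [folklore] -/
theorem kerProj_conjTranspose (Q : Matrix m n 𝕜) : (kerProj Q)ᴴ = kerProj Q := (kerProj_isHermitian Q).eq

/-- **`Q · kerProj Q = 0`**: the range of the projector lies in `ker Q` (the vector `Q x` is orthogonal to `ker (QQᴴ) = ker Qᴴ`, so the
pseudo-inverse reproduces it). [folklore] -/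
theorem mulVec_kerProj (Q : Matrix m n 𝕜) (x : n → 𝕜) : Q *ᵥ (kerProj Q *ᵥ x) = 0 := by
  have hG := Matrix.isHermitian_mul_conjTranspose_self Q
  have key : (Q * Qᴴ) *ᵥ (hpinv hG *ᵥ (Q *ᵥ x)) = Q *ᵥ x := by
    refine mulVec_hpinv_mulVec_of_orth_ker hG fun z hz => ?_
    -- `QQᴴ z = 0 ⟹ Qᴴ z = 0 ⟹ ⟨z, Qx⟩ = ⟨Qᴴ z, x⟩ = 0`
    have h1 : star z ⬝ᵥ ((Q * Qᴴ) *ᵥ z) = 0 := by rw [hz, dotProduct_zero]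
    have h2 : star (Qᴴ *ᵥ z) ⬝ᵥ (Qᴴ *ᵥ z) = 0 := by
      rw [conj_pairing, conjTranspose_conjTranspose, mulVec_mulVec]
      exact h1
    have h3 : Qᴴ *ᵥ z = 0 := dotProduct_star_self_eq_zero.mp h2
    rw [← conjTranspose_conjTranspose Q, ← conj_pairing, h3, star_zero, zero_dotProduct]
  rw [← mulVec_mulVec] at key
  unfold kerProj
  simp only [sub_mulVec, one_mulVec, mulVec_sub, ← mulVec_mulVec]
  rw [key, sub_self]

/-- `kerProj Q` FIXES `ker Q`: `Q v = 0 ⟹ kerProj Q v = v`. [folklore] -/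
theorem kerProj_mulVec_of_mem_ker (Q : Matrix m n 𝕜) {v : n → 𝕜} (hv : Q *ᵥ v = 0) : kerProj Q *ᵥ v = v := by
  unfold kerProj
  rw [sub_mulVec, one_mulVec, ← mulVec_mulVec, ← mulVec_mulVec, hv, mulVec_zero, mulVec_zero, sub_zero]

/-- `kerProj Q` is idempotent. [folklore] -/
theorem kerProj_mulVec_kerProj (Q : Matrix m n 𝕜) (x : n → 𝕜) : kerProj Q *ᵥ (kerProj Q *ᵥ x) = kerProj Q *ᵥ x :=
  kerProj_mulVec_of_mem_ker Q (mulVec_kerProj Q x)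

/-- Moving the projector across the pairing: `⟨P x, y⟩ = ⟨x, P y⟩`. [folklore] -/
theorem kerProj_pairing (Q : Matrix m n 𝕜) (x y : n → 𝕜) : star (kerProj Q *ᵥ x) ⬝ᵥ y = star x ⬝ᵥ (kerProj Q *ᵥ y) := by
  rw [conj_pairing, kerProj_conjTranspose]

end KerProj

/-! ## §3 The canonical constrained covariance and its critical columns -/

section CritCov

variable {𝕜 : Type*} [RCLike 𝕜] {n m : Type*} [Fintype n] [DecidableEq n] [Fintype m] [DecidableEq m]

/-- The compressed form `P H P` is Hermitian for Hermitian `H`. [folklore] -/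
theorem isHermitian_compress (Q : Matrix m n 𝕜) {H : Matrix n n 𝕜} (hH : H.IsHermitian) :
    (kerProj Q * H * kerProj Q).IsHermitian := by
  have h := Matrix.isHermitian_mul_mul_conjTranspose (kerProj Q) hH
  rwa [kerProj_conjTranspose] at h

/-- **THE CANONICAL CONSTRAINED COVARIANCE** of the (possibly degenerate) form `H` under the hard constraints `Q v = 0`, with NO gauge
fixing: `critCov H Q := P (P H P)⁺ P`, `P = kerProj Q`. [folklore] -/
noncomputable def critCov {H : Matrix n n 𝕜} (hH : H.IsHermitian) (Q : Matrix m n 𝕜) : Matrix n n 𝕜 :=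
  kerProj Q * hpinv (isHermitian_compress Q hH) * kerProj Q

/-- `critCov` is Hermitian. [folklore] -/
theorem critCov_isHermitian {H : Matrix n n 𝕜} (hH : H.IsHermitian) (Q : Matrix m n 𝕜) : (critCov hH Q).IsHermitian := by
  have h := Matrix.isHermitian_mul_mul_conjTranspose (kerProj Q) (hpinv_isHermitian (isHermitian_compress Q hH))
  rwa [kerProj_conjTranspose] at h

/-- `(critCov H Q)ᴴ = critCov H Q`. [folklore] -/
theorem critCov_conjTranspose {H : Matrix n n 𝕜} (hH : H.IsHermitian) (Q : Matrix m n 𝕜) : (critCov hH Q)ᴴ = critCov hH Q :=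
  (critCov_isHermitian hH Q).eq

/-- Every column of `critCov H Q` satisfies the constraints: `Q (critCov H Q r) = 0`. [folklore] -/
theorem mulVec_critCov_mem_ker {H : Matrix n n 𝕜} (hH : H.IsHermitian) (Q : Matrix m n 𝕜) (r : n → 𝕜) :
    Q *ᵥ (critCov hH Q *ᵥ r) = 0 := by
  unfold critCov
  rw [← mulVec_mulVec, ← mulVec_mulVec]
  exact mulVec_kerProj Q _

/-- `critCov H Q r ∈ ker Q` as a submodule statement. [folklore] -/
theorem critCov_mem_ker {H : Matrix n n 𝕜} (hH : H.IsHermitian) (Q : Matrix m n 𝕜) (r : n → 𝕜) :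
    critCov hH Q *ᵥ r ∈ LinearMap.ker Q.mulVecLin := by
  simpa [LinearMap.mem_ker, Matrix.mulVecLin_apply] using mulVec_critCov_mem_ker hH Q r

/-- **THE COLUMNS OF `critCov` ARE CRITICAL.**  `H` positive semidefinite, `r` orthogonal to the CONSTRAINED ZERO MODES
(`Q z = 0 ∧ H z = 0 ⟹ ⟨z, r⟩ = 0`) ⟹ `IsCrit H r (ker Q) (critCov H Q r)`: the column lies in `ker Q` and `r − H·(column) ⊥ ker Q`.
(For a lattice gauge field: `H` = curl energy, `Q` = block averages, zero modes = pure gauges with block-constant generator, legitimate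
`r` = sources with block-constant divergence, in particular transverse ones.) [folklore] -/
theorem isCrit_critCov {H : Matrix n n 𝕜} (hH : H.PosSemidef) (Q : Matrix m n 𝕜) {r : n → 𝕜}
    (hr : ∀ z, Q *ᵥ z = 0 → H *ᵥ z = 0 → star z ⬝ᵥ r = 0) :
    IsCrit H r (LinearMap.ker Q.mulVecLin) (critCov hH.isHermitian Q *ᵥ r) := by
  have hB := isHermitian_compress Q hH.isHermitian
  -- `P r` is orthogonal to `ker (P H P)`
  have horth : ∀ x, (kerProj Q * H * kerProj Q) *ᵥ x = 0 → star x ⬝ᵥ (kerProj Q *ᵥ r) = 0 := by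
    intro x hx
    have h1 : star (kerProj Q *ᵥ x) ⬝ᵥ (H *ᵥ (kerProj Q *ᵥ x)) = 0 := by
      rw [kerProj_pairing, mulVec_mulVec, mulVec_mulVec, hx, dotProduct_zero]
    have h2 : H *ᵥ (kerProj Q *ᵥ x) = 0 := (hH.dotProduct_mulVec_zero_iff _).mp h1
    rw [← kerProj_pairing]
    exact hr _ (mulVec_kerProj Q x) h2
  have key := mulVec_hpinv_mulVec_of_orth_ker hB horth
  -- unfold the column
  have hcol : critCov hH.isHermitian Q *ᵥ r = kerProj Q *ᵥ (hpinv hB *ᵥ (kerProj Q *ᵥ r)) := by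
    unfold critCov
    rw [← mulVec_mulVec, ← mulVec_mulVec]
  refine ⟨critCov_mem_ker hH.isHermitian Q r, fun w hw => ?_⟩
  have hw' : Q *ᵥ w = 0 := by simpa [LinearMap.mem_ker, Matrix.mulVecLin_apply] using hw
  have hPw : kerProj Q *ᵥ w = w := kerProj_mulVec_of_mem_ker Q hw'
  -- `⟨w, r − H v⟩ = ⟨P w, r − H v⟩ = ⟨w, P r − P H v⟩` and `P H v = P H P (B⁺ P r) = P r`
  have hPHv : kerProj Q *ᵥ (H *ᵥ (critCov hH.isHermitian Q *ᵥ r)) = kerProj Q *ᵥ r := by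
    rw [hcol, mulVec_mulVec, mulVec_mulVec]
    exact key
  calc star w ⬝ᵥ (r - H *ᵥ (critCov hH.isHermitian Q *ᵥ r))
        = star (kerProj Q *ᵥ w) ⬝ᵥ (r - H *ᵥ (critCov hH.isHermitian Q *ᵥ r)) := by rw [hPw]
    _ = star w ⬝ᵥ (kerProj Q *ᵥ (r - H *ᵥ (critCov hH.isHermitian Q *ᵥ r))) := kerProj_pairing Q _ _
    _ = 0 := by rw [mulVec_sub, hPHv, sub_self, dotProduct_zero]

omit [DecidableEq n] [Fintype m] [DecidableEq m] in
/-- **CONVERSELY**: if some point is critical for `(H, r)` on a subspace `K`, then `r` is orthogonal to every zero mode of `H` in `K`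
(so the hypothesis of `isCrit_critCov` is necessary). [folklore] -/
theorem orth_zeroModes_of_isCrit {H : Matrix n n 𝕜} (hH : H.IsHermitian) {r v : n → 𝕜} {K : Submodule 𝕜 (n → 𝕜)}
    (hcrit : IsCrit H r K v) {z : n → 𝕜} (hzK : z ∈ K) (hzH : H *ᵥ z = 0) : star z ⬝ᵥ r = 0 := by
  have h := hcrit.2 z hzK
  have h2 : star z ⬝ᵥ (H *ᵥ v) = 0 := by
    rw [← conjTranspose_conjTranspose H, ← conj_pairing, hH.eq, hzH, star_zero, zero_dotProduct]
  rwa [dotProduct_sub, h2, sub_zero] at h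

/-- **SLICE INDEPENDENCE, read through `critCov`**: any critical point `v` of `(H, r)` on `ker Q` (e.g. the KKT column of a legitimate
gauge slice) has the same pairing as the canonical column: `⟨r, v⟩ = ⟨r, critCov H Q r⟩`. [folklore] -/
theorem pairing_eq_critCov {H : Matrix n n 𝕜} (hH : H.PosSemidef) (Q : Matrix m n 𝕜) {r v : n → 𝕜}
    (hv : IsCrit H r (LinearMap.ker Q.mulVecLin) v) :
    star r ⬝ᵥ v = star r ⬝ᵥ (critCov hH.isHermitian Q *ᵥ r) := by
  refine MonotoneCoarsen.pairing_eq_of_isCrit hH hv (isCrit_critCov hH Q fun z hzQ hzH => ?_)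
  exact orth_zeroModes_of_isCrit hH.isHermitian hv (by simpa [LinearMap.mem_ker, Matrix.mulVecLin_apply] using hzQ) hzH

end CritCov

end Summit.QuantumFields.BalabanUV.Beta.GAN24.MonotoneCritical
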